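import Summits.QuantumFields.Statement

/-!
# Sketch — crux-ideate stmt-QuantumFields-11512 (PauliWegnerSea.FMClosureUnquenched), ideator 1, round 1

First lemmas of the two idea cards (statements only; they must elaborate, they are not proved here):

* `AntiperiodicPionLogConvex` — card `transfer-logconvex-inward`: Lüscher positivity of the
  Wilson (r = 1, bare masses > −1) transfer matrix makes the phase-quenched second moment of the
  quark propagator — the honest pion two-point function when the masses come in degenerate pairs —
  LOG-CONVEX in Euclidean time in the auxiliary theory that is ANTIPERIODIC for quarks across one
  time seam (the statement's own torus is time-periodic, a `(−1)^F`-twisted trace, cf. the docstring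
  of `qcdTorusExpect`).
* `ExitMomentFarStability` — card `thick-collar-far-stability`: conditioning the phase-quenched
  Wilson measure on everything beyond a collar as thick as the box distorts the Dirichlet box EXIT
  MOMENT of the quark propagator by at most `e^K · e^{pβ} · poly(ℓ)` up to an additive, far-uniformly
  `e^{−K/C}`-rare collar event — the one property of the measure that replaces independence in the
  Aizenman–Schenker–Friedrich–Hundertmark bootstrap once the second depletion set is a thick collar.
-/

namespace Summit.QuantumFields.QCD.Cruxes.FMClosureUnquenched.Sketch

open scoped BigOperators
open MeasureTheory Filter

/-- Card `transfer-logconvex-inward`, first lemma. For pairwise-degenerate bare masses all `> −1`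
(κ < 1/6, Lüscher's positivity domain), β ≥ 0, on the torus of side `2S+1`: let `D_ap(U)` be the
tree's `diracMatrix U mq` with the sign of every hopping entry across the time seam
`{x₀ = 2S} ~ {x₀ = 0}` flipped (antiperiodic quarks in direction 0), and
`π(n) = ∫ ‖det D_ap‖ · Σ_{a,i,b,j} ‖D_ap⁻¹((f,0,a,i),(f,n e₀,b,j))‖² dμ_W / ∫ ‖det D_ap‖ dμ_W`
(phase-quenched = honest two-pair weight; the summand is `tr G G† =` the charged pion correlator in
the background). Then `π` is log-convex away from the contact points: `π(t)² ≤ π(t−1) π(t+1)` for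
`2 ≤ t ≤ 2S − 1`. Source: transfer-matrix spectral representation
`π(t) = Tr(𝕋^{N−t} P̂ 𝕋^t P̂†)/Tr 𝕋^N = Σ_{ij} |P̂_{ij}|² λ_i^{N−t} λ_j^t / Z` with `𝕋 ≥ 0`
(Lüscher, Commun. Math. Phys. 54 (1977) 283; Osterwalder–Seiler 1978). -/
def AntiperiodicPionLogConvex : Prop :=
  open MeasureTheory Filter Literature.MathematicalPhysics.QuantumFieldTheory
    Literature.MathematicalPhysics.QuantumLattice Literature.Probability.LatticeModels in
  ∀ (Nf : ℕ) (mq : Fin Nf → ℝ),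
    (∃ σ : Equiv.Perm (Fin Nf), (∀ f, σ f ≠ f) ∧ (∀ f, σ (σ f) = f) ∧ ∀ f, mq (σ f) = mq f) →
    (∀ f, -1 < mq f) →
    ∀ (β : ℝ), 0 ≤ β → ∀ (S : ℕ), 1 ≤ S → ∀ (f : Fin Nf) (t : ℕ), 2 ≤ t → t + 2 ≤ 2 * S + 1 →
      let seam : FermiIdx Nf (2 * S + 1) → FermiIdx Nf (2 * S + 1) → Prop := fun p q =>
        (((quarkEquiv (Nf := Nf) (L := 2 * S + 1)).symm p).2.1 0 = ((2 * S : ℕ) : ZMod (2 * S + 1)) ∧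
            ((quarkEquiv (Nf := Nf) (L := 2 * S + 1)).symm q).2.1 0 = 0) ∨
          (((quarkEquiv (Nf := Nf) (L := 2 * S + 1)).symm p).2.1 0 = 0 ∧
            ((quarkEquiv (Nf := Nf) (L := 2 * S + 1)).symm q).2.1 0 = ((2 * S : ℕ) : ZMod (2 * S + 1)))
      let Dap : GaugeConfig 4 (2 * S + 1) (Matrix.specialUnitaryGroup (Fin 3) ℂ) →
          Matrix (FermiIdx Nf (2 * S + 1)) (FermiIdx Nf (2 * S + 1)) ℂ := fun U =>
        Matrix.of fun p q => if seam p q then -(diracMatrix U mq p q) else diracMatrix U mq p q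
      let π : ℕ → ℝ := fun n =>
        (∫ U : GaugeConfig 4 (2 * S + 1) (Matrix.specialUnitaryGroup (Fin 3) ℂ),
            ‖(Dap U).det‖ *
              (∑ a : Fin 3, ∑ i : Fin 4, ∑ b : Fin 3, ∑ j : Fin 4,
                ‖(Dap U)⁻¹ (quarkEquiv (f, (Torus.proj (2 * S + 1) 0, a, i)))
                    (quarkEquiv (f, (Torus.proj (2 * S + 1) (Pi.single 0 (n : ℤ)), b, j)))‖ ^ 2)
            ∂(wilsonMeasure (fundamentalRep (Fin 3)) β)) /
          (∫ U : GaugeConfig 4 (2 * S + 1) (Matrix.specialUnitaryGroup (Fin 3) ℂ),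
            ‖(Dap U).det‖ ∂(wilsonMeasure (fundamentalRep (Fin 3)) β))
      π t ^ 2 ≤ π (t - 1) * π (t + 1)

/-- Card `thick-collar-far-stability`, first lemma (the load-bearing measure input, isolated in the
exact form the thick-collar bootstrap consumes it). Torus of side `N = 2S+1`, phase-quenched law
`ν ∝ ‖det diracMatrix‖ · μ_W(β)`, bare masses in `[−2,2]`. Let `W = B_∞(0,ℓ)` (sites `Torus.proj v`,
`v ∈ box 4 ℓ`), `D̃(U) = D_W ⊕ 1` (the tree's `diracMatrix U mq` with every entry between an inside
and an outside quark index zeroed and the outside block replaced by the identity — so `D̃⁻¹` restricted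
to inside indices is the DIRICHLET box Green function `G_W`), and the box EXIT MOMENT of flavour `f`
`F_s(U) = Σ_{‖v‖∞ = ℓ} Σ_{a,i,b,j} ‖G_W((f,0,a,i),(f,v,b,j))‖^s`. FAR STABILITY: for every
non-negative bounded `Ψ` depending only on links with both endpoints outside `B_∞(0,3ℓ)` and every
trade-off parameter `K ≥ 0`,
`E_ν[F_s Ψ] ≤ ( C e^{pβ} (1+ℓ)^p e^{K} · E_ν[F_s] + C e^{pβ} (1+ℓ)^p e^{−K/C} ) · E_ν[Ψ]`,
uniformly in `S ≥ 8ℓ`: conditioning on ANY field beyond a collar as thick as the box distorts the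
exit moment by at most `e^{K} · poly` except on a far-uniformly `e^{−K/C}`-rare collar event
(coherent large collar fields, handled by a conditional Peierls bound). Equivalent ess-sup form:
`E_ν[F_s | links outside B(0,3ℓ)] ≤ C e^{pβ}(1+ℓ)^p (e^{K} E_ν[F_s] + e^{−K/C})` a.s. The naive
sup-form ratio-mixing for ARBITRARY inside functionals is false already for a compact Gaussian
caricature (aligned coherent fields give `e^{cβℓ²}`), which is why the lemma is about this functional. -/
def ExitMomentFarStability : Prop :=
  open MeasureTheory Filter Literature.MathematicalPhysics.QuantumFieldTheory
    Literature.MathematicalPhysics.QuantumLattice Literature.Probability.LatticeModels in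
  open scoped Classical in
  ∀ (Nf : ℕ) (s : ℝ), 0 < s → s < 1 → ∃ (p : ℕ) (C : ℝ), 0 < C ∧ ∀ β : ℝ, 0 ≤ β →
    ∀ mq : Fin Nf → ℝ, (∀ f, -2 ≤ mq f ∧ mq f ≤ 2) → ∀ (S ℓ : ℕ), 1 ≤ ℓ → 8 * ℓ ≤ S →
    ∀ (f : Fin Nf) (K : ℝ), 0 ≤ K →
    ∀ (Ψ : GaugeConfig 4 (2 * S + 1) (Matrix.specialUnitaryGroup (Fin 3) ℂ) → ℝ),
      Measurable Ψ → (∀ U, 0 ≤ Ψ U) → (∃ M : ℝ, ∀ U, Ψ U ≤ M) →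
      (∀ U V : GaugeConfig 4 (2 * S + 1) (Matrix.specialUnitaryGroup (Fin 3) ℂ),
        (∀ e : Edge 4 (2 * S + 1),
          (∀ v ∈ box 4 (3 * ℓ), e.1 ≠ Torus.proj (2 * S + 1) v) →
          (∀ v ∈ box 4 (3 * ℓ), Site.shift e.1 e.2 ≠ Torus.proj (2 * S + 1) v) → U e = V e) →
        Ψ U = Ψ V) →
      let inside : FermiIdx Nf (2 * S + 1) → Prop := fun r =>
        ∃ v ∈ box 4 ℓ, ((quarkEquiv (Nf := Nf) (L := 2 * S + 1)).symm r).2.1 = Torus.proj (2 * S + 1) v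
      let Dtil : GaugeConfig 4 (2 * S + 1) (Matrix.specialUnitaryGroup (Fin 3) ℂ) →
          Matrix (FermiIdx Nf (2 * S + 1)) (FermiIdx Nf (2 * S + 1)) ℂ := fun U =>
        Matrix.of fun r r' =>
          if inside r ∧ inside r' then diracMatrix U mq r r' else (if r = r' then 1 else 0)
      let F : GaugeConfig 4 (2 * S + 1) (Matrix.specialUnitaryGroup (Fin 3) ℂ) → ℝ := fun U =>
        ∑ v ∈ (box 4 ℓ).filter (fun v => ‖v‖ = (ℓ : ℝ)),
          ∑ a : Fin 3, ∑ i : Fin 4, ∑ b : Fin 3, ∑ j : Fin 4,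
            ‖(Dtil U)⁻¹ (quarkEquiv (f, (Torus.proj (2 * S + 1) 0, a, i)))
                (quarkEquiv (f, (Torus.proj (2 * S + 1) v, b, j)))‖ ^ s
      let μ : Measure (GaugeConfig 4 (2 * S + 1) (Matrix.specialUnitaryGroup (Fin 3) ℂ)) :=
        wilsonMeasure (fundamentalRep (Fin 3)) β
      let w : GaugeConfig 4 (2 * S + 1) (Matrix.specialUnitaryGroup (Fin 3) ℂ) → ℝ := fun U =>
        ‖(diracMatrix U mq).det‖
      let Z : ℝ := ∫ U, w U ∂μ
      (∫ U, w U * (F U * Ψ U) ∂μ) / Z ≤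
        (C * Real.exp (p * β) * (1 + (ℓ : ℝ)) ^ p * Real.exp K * ((∫ U, w U * F U ∂μ) / Z) +
            C * Real.exp (p * β) * (1 + (ℓ : ℝ)) ^ p * Real.exp (-(K / C))) *
          ((∫ U, w U * Ψ U ∂μ) / Z)

end Summit.QuantumFields.QCD.Cruxes.FMClosureUnquenched.Sketch
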